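import Literature.NumberTheory.GaloisRepresentations.ArtinCharacterLocalGlobalProofs
import Literature.NumberTheory.GaloisRepresentations.HeckeCharacterGaloisAvatarProofs
import Literature.NumberTheory.GaloisRepresentations.GlobalReciprocityCharacterFormProofs
import Literature.NumberTheory.GaloisRepresentations.LocalArtinMapPinned
import Literature.NumberTheory.GaloisRepresentations.WeilGroupDensityProofs
import Literature.NumberTheory.GaloisRepresentations.WeilGroupProofs
import Literature.NumberTheory.GaloisRepresentations.TateH2VanishingCharacterCriterion
import Literature.NumberTheory.GaloisRepresentations.CharacterPrescribedLocalComponents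
import Literature.NumberTheory.NumberFields.ChevalleySubgroupCongruenceProofs
import Literature.NumberTheory.NumberFields.IdeleOpenSubgroupFiniteIndex
import Mathlib.Algebra.Module.CharacterModule
import Mathlib.RingTheory.RootsOfUnity.Complex
import HarnessLib

/-!
# Finite-order characters of a number field with prescribed components at finitely many places:
# proof of `ClozelHarrisTaylor2008.exists_character_restrict_eq` (Clozel–Harris–Taylor 2008, Lemma 4.1.1)

Topic `NumberTheory/GaloisRepresentations`; namespace
`Literature.NumberTheory.GaloisRepresentations.ClozelHarrisTaylor2008`.  Sibling PROOF file of
`CharacterPrescribedLocalComponents.lean`: it discharges the named fact stated there,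

* `exists_character_restrict_eq_holds : exists_character_restrict_eq` — for a number field `F`, a
  finite set `S` of finite places and locally constant additive characters `χ_v : Γ_{F_v} → ℚ/ℤ`
  (`v ∈ S`), there is a locally constant additive `ψ : Γ_F → ℚ/ℤ` with `ψ ∘ res_v = χ_v` for every
  `v ∈ S` (`res_v = absGaloisRestrict F F_v`); i.e. `H¹(F, ℚ/ℤ) → ⊕_{v ∈ S} H¹(F_v, ℚ/ℤ)` is onto.

Theorems only (no definition, no named fact, no instance; D-0026); axioms `propext`,
`Classical.choice`, `Quot.sound`.

## Source and the printed proof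

L. Clozel, M. Harris, R. Taylor, *Automorphy for some `l`-adic lifts of automorphic mod `l` Galois
representations*, Publ. Math. IHÉS 108 (2008), §4.1 (held text `paper:doi-10-1007-s10240-008-0016-1`,
p. 116), **Lemma 4.1.1**: «Suppose that `F` is a number field and that `S` is a finite set of places of
`F`. Suppose also that `χ_S : ∏_{v∈S} F_vˣ → ℚ̄ˣ` is a continuous character of finite order. Then there is
a continuous character `χ : Fˣ\𝔸_Fˣ → ℚ̄ˣ` such that `χ|_{∏_{v∈S} F_vˣ} = χ_S`. *Proof.* One may suppose
that `S` contains all infinite places. Then we choose an open subgroup `U ⊂ (𝔸_F^S)ˣ` such that `χ_S`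
is trivial on `U ∩ Fˣ`. (This is possible as any finite index subgroup of `𝒪_Fˣ` is a congruence
subgroup.) Then we can extend `χ_S` to `U ∏_{v∈S} F_vˣ/(U ∩ Fˣ)` by setting it to one on `U`. Finally
we can extend this character to `𝔸_Fˣ/Fˣ` (which contains `U ∏_{v∈S} F_vˣ/(U ∩ Fˣ)` as an open
subgroup).»

The fact is the GALOIS FORM at finite places (transport by local and global reciprocity, as its
docstring explains).  The proof below is the printed one followed by that transport, one place
`v₀ ∈ S` at a time (prescribed character at `v₀`, trivial character at the other places of `S`), the
general case being the sum over `v₀ ∈ S`: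

* §0 `exists_addCircle_character` — the exponential `e : ℚ/ℤ → ℂˣ`, `q ↦ e^{2πiq}`: injective, onto
  the elements of finite order (the tree's Hecke characters are `ℂˣ`-valued, the fact is `ℚ/ℤ`-valued).
* §1 `exists_character_comp_canonicalArtin` — LOCAL RECIPROCITY ON CHARACTERS: `χ_v ∘ (W_{F_v} → Γ_{F_v})`
  kills `ker Art_{F_v} = closure [W, W]` (the clauses `IsLocalArtinMap` of THE pinned local Artin map,
  `isLocalArtinMap_canonicalArtin_holds`; `character_apply_eq_zero_of_mem_closure_commutator`), so it
  is `χ' ∘ Art_{F_v}` for a locally constant additive `χ' : F_vˣ → ℚ/ℤ` (`Art_{F_v}` is an open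
  quotient map).
* §2 `exists_modulus_sUnit_character` — «any finite index subgroup of `𝒪_Fˣ` is a congruence subgroup»,
  here for the `S`-units (the group `U ∩ Fˣ` of the printed proof consists of `S`-units): CHEVALLEY'S
  THÉORÈME 1 (`NumberFields.Chevalley1951.thm1_holds`) for the finitely generated group of `S`-units
  (`DiophantineGeometry.instGroupFG_sUnit`) gives `a ≥ 1` prime to `S` such that `χ' ∘ (Fˣ → F_{v₀}ˣ)`
  kills every `S`-unit `≡ 1 (mod a)`; `exists_hasse_of_valuation_sub_one_le` turns the local
  congruences `|b − 1|_𝔭 ≤ |a|_𝔭` into Hasse's multiplicative congruence used by that theorem.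
* §3 `exists_heckeCharacter_localComponent` — THE IDELIC CONSTRUCTION: `U = {x : |x_v| = 1 and
  |x_v − 1|_v ≤ |a|_v for finite v ∉ S, χ'(x_{v₀}) = 0}` is open, `Ñ = Fˣ U` is open of finite index
  (`NumberFields.finiteIndex_of_isOpen_of_principalIdeles_le`, Tate's remark after VII 5.1 (D)), `χ'` is
  trivial on the kernel of `F_{v₀}ˣ → 𝕀_F/Ñ` (§2), hence descends to its image and EXTENDS to `𝕀_F/Ñ`
  (`exists_character_comp_eq`: `ℚ/ℤ` is an injective `ℤ`-module, Mathlib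
  `CharacterModule.dual_surjective_of_injective`) — «extend … by setting it to one on `U` … extend this
  character to `𝔸_Fˣ/Fˣ`»; `θ = e ∘ φ₀ ∘ (𝕀_F → 𝕀_F/Ñ)` is a Hecke character of finite order
  (`heckeOfIdeleQuotientChar`) with `θ_{v₀} = e ∘ χ'` and `θ_v = 1` for `v ∈ S ∖ {v₀}`.
* §4 `exists_character_restrict_eq_single` — GLOBAL RECIPROCITY ON CHARACTERS: by the existence
  theorem in character form (`HeckeCharacter.exists_eq_charHecke_of_isFiniteOrder`, Tate VII 5.1
  (B)+(D)) `θ = χ_L ∘ ψ_{L|F}` for a finite abelian `L ⊆ F̄` and a character `χ_L` of `G(L|F)`; put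
  `ψ = e⁻¹ ∘ χ_L⁻¹ ∘ r_L`.  On `W_{F_v}` the LOCAL–GLOBAL COMPATIBILITY
  `ψ_{L|F}(ι_v(Art_v w)) · (res w)|_L = 1` (Neukirch VI (5.6), the tree's
  `ArtinLocalGlobal.artinIdeleMap_localUnits_mul_absRestrictNormalHom`) gives
  `e(ψ(res w)) = θ(ι_v(Art_v w))`, which is `e(χ_{v₀}(w))` at `v₀` (§1, §3) and `1` at the other `v ∈ S`;
  both sides are locally constant on `Γ_{F_v}` and `W_{F_v}` is dense
  (`WeilGroup.denseRange_toAbsGalois_holds`), and `e` is injective.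
* §5 `exists_character_restrict_eq_holds` — the sum over `v₀ ∈ S`.
* §6 `exists_heckeCharacter_isFiniteOrder_localComponent_eq` — THE PRINTED (IDELIC) FORM at finite
  places: for characters `χ_v : F_vˣ → ℂˣ` (`v ∈ S`) of finite order with open kernel there is a Hecke
  character `θ` of finite order with `θ_v = χ_v` for every `v ∈ S` (write `χ_v = e ∘ χ'_v`, apply §3
  at each `v₀ ∈ S`, multiply over `S`).  The fact's `TODO(idelic form)` except for real places.

## References

* [ClozelHarrisTaylor2008] L. Clozel, M. Harris, R. Taylor, Publ. Math. IHÉS 108 (2008), §4.1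
  Lemma 4.1.1 (p. 116).
* [CasselsFrohlichANT1967] J.-P. Serre, *Local class field theory* (Ch. VI, §2), J. Tate, *Global
  class field theory* (Ch. VII, §5.1 Main Theorem (B), (D) and the remark after (D), §6), in:
  J. W. S. Cassels, A. Fröhlich (eds.), *Algebraic Number Theory*, Academic Press 1967.
* [NeukirchANT1999] J. Neukirch, *Algebraic Number Theory*, Springer 1999, Ch. VI §1 (1.7)–(1.9),
  §5 Prop. (5.6), §6 Thm. (6.1).
* [ChevalleyDeuxTheoremes1951] C. Chevalley, *Deux théorèmes d'arithmétique*, J. Math. Soc. Japan 3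
  (1951) 36–44, Théorème 1.

## Mathlib / tree search

Tree inputs (consumed by name): `canonicalArtin`, `isLocalArtinMap_canonicalArtin_holds`
(`LocalArtinMapPinned`), `IsLocalArtinMap.isOpenQuotientMap_artin/ker_artin` (`LocalClassFieldTheory`),
`WeilGroup.isTopologicalGroup_holds`, `WeilGroup.continuous_toAbsGalois'`,
`WeilGroup.denseRange_toAbsGalois_holds`, `character_apply_eq_zero_of_mem_closure_commutator`,
`character_apply_one/_pow` (`TateH2VanishingCharacterCriterion`), `NumberFields.Chevalley1951.thm1_holds`
(`ChevalleySubgroupCongruenceProofs`), `DiophantineGeometry.instGroupFG_sUnit` (`SUnitTheorem`),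
`ideleGroup`, `principalIdeles`, `principalIdele`, `localUnits`, `globalToLocalUnits`,
`valued_algebraMap_adicCompletion`, `continuous_ideleGroup_snd_apply`, `unitIdeles`, `isOpen_unitIdeles`,
`congruenceIdeles`, `modulusExp`, `congruenceIdeles_mem_nhds_one` (`HeckeCharacter*`, `UnitIdeles`,
`HeckeCharacterOfRayClass`), `NumberFields.finiteIndex_of_isOpen_of_principalIdeles_le`
(`IdeleOpenSubgroupFiniteIndex`), `heckeOfIdeleQuotientChar`, `isFiniteOrder_heckeOfIdeleQuotientChar`
(`GlobalReciprocityCharacterFormProofs`), `HeckeCharacter.exists_eq_charHecke_of_isFiniteOrder`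
(`HeckeCharacterGaloisAvatarProofs`), `charHecke`, `apply_artinIdeleMap`, `absRestrictNormalHom`,
`isOpen_ker_absRestrictNormalHom` (`GlobalArtinMapOfCharactersProofs`),
`ArtinLocalGlobal.artinIdeleMap_localUnits_mul_absRestrictNormalHom` (`ArtinCharacterLocalGlobalProofs`),
`absGaloisRestrict` (`AbsGaloisGroup`).  Mathlib: `CharacterModule.dual_surjective_of_injective`,
`AddMonoidHom.liftOfSurjective`, `Complex.exp_eq_one_iff`, `Complex.mem_rootsOfUnity`,
`DenseRange.equalizer`, `IsLocallyConstant.range_finite/comp/comp₂/comp_continuous`,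
`IsFractionRing.div_surjective`, `Ideal.absNorm_mem`, `HeightOneSpectrum.mem_integers_of_valuation_le_one`,
`Nat.recOnPosPrimePosCoprime`.  `lean search 'exists_character_restrict_eq_holds|CharacterPrescribedLocalComponentsProofs'`:
no prior hits.
-/

noncomputable section

open scoped NumberField
open NumberField IsDedekindDomain Field Complex
open scoped Real

namespace Literature.NumberTheory.GaloisRepresentations

namespace ClozelHarrisTaylor2008

/-! ### §0. The character `e : ℚ/ℤ → ℂˣ`, `q ↦ exp(2πiq)` -/

/-- **The exponential character `ℚ/ℤ → ℂˣ`, `q ↦ e^{2πiq}`**: an injective homomorphism whose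
image contains every element of finite order of `ℂˣ` (the roots of unity `e^{2πik/n}`).
[folklore] -/
private theorem exists_addCircle_character :
    ∃ e : AddCircle (1 : ℚ) → ℂˣ, e 0 = 1 ∧ (∀ x y, e (x + y) = e x * e y) ∧
      Function.Injective e ∧ ∀ z : ℂˣ, IsOfFinOrder z → ∃ q, e q = z := by
  -- the homomorphism `ℚ → ℂˣ`
  let E : ℚ →+ Additive ℂˣ :=
    { toFun := fun q => Additive.ofMul (Units.mk0 (exp (2 * π * I * (q : ℂ))) (exp_ne_zero _))
      map_zero' := by
        apply Additive.toMul.injective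
        apply Units.ext
        simp
      map_add' := fun q q' => by
        apply Additive.toMul.injective
        apply Units.ext
        simp only [toMul_ofMul, Units.val_mk0, toMul_add, Units.val_mul, Rat.cast_add, mul_add,
          exp_add] }
  have hE : ∀ q : ℚ, ((Additive.toMul (E q) : ℂˣ) : ℂ) = exp (2 * π * I * (q : ℂ)) := fun q => rfl
  -- it kills `ℤ`
  have hker : AddSubgroup.zmultiples (1 : ℚ) ≤ E.ker := by
    intro q hq
    obtain ⟨n, rfl⟩ := AddSubgroup.mem_zmultiples_iff.mp hq
    rw [AddMonoidHom.mem_ker]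
    apply Additive.toMul.injective
    apply Units.ext
    rw [hE]
    change exp (2 * π * I * ((n • (1 : ℚ) : ℚ) : ℂ)) = ((1 : ℂˣ) : ℂ)
    rw [Units.val_one, zsmul_one, Rat.cast_intCast,
      show 2 * π * I * (n : ℂ) = n * (2 * π * I) by ring]
    exact exp_int_mul_two_pi_mul_I n
  let ē : AddCircle (1 : ℚ) →+ Additive ℂˣ := QuotientAddGroup.lift _ E hker
  have hē : ∀ q : ℚ, ē (q : AddCircle (1 : ℚ)) = E q := fun q => QuotientAddGroup.lift_mk' _ _ q
  refine ⟨fun x => Additive.toMul (ē x), ?_, fun x y => ?_, fun x y hxy => ?_, fun z hz => ?_⟩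
  · show Additive.toMul (ē 0) = 1
    rw [map_zero]; rfl
  · show Additive.toMul (ē (x + y)) = Additive.toMul (ē x) * Additive.toMul (ē y)
    rw [map_add]; rfl
  · -- injectivity: `exp (2πiq) = 1` forces `q ∈ ℤ`
    have hxy' : ē x = ē y := Additive.toMul.injective hxy
    rw [← sub_eq_zero, ← map_sub] at hxy'
    rw [← sub_eq_zero]
    induction x using QuotientAddGroup.induction_on with
    | H qx =>
    induction y using QuotientAddGroup.induction_on with
    | H qy =>
    rw [← QuotientAddGroup.mk_sub, hē] at hxy'
    rw [← QuotientAddGroup.mk_sub, QuotientAddGroup.eq_zero_iff]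
    have h1 : exp (2 * π * I * ((qx - qy : ℚ) : ℂ)) = 1 := by
      rw [← hE, hxy']; rfl
    obtain ⟨n, hn⟩ := exp_eq_one_iff.mp h1
    have hπ : (2 * π * I : ℂ) ≠ 0 := by simp [Real.pi_ne_zero, I_ne_zero]
    have h2 : ((qx - qy : ℚ) : ℂ) = (n : ℂ) :=
      mul_right_cancel₀ hπ (by rw [mul_comm]; exact hn)
    have h3 : (qx - qy : ℚ) = (n : ℚ) := by exact_mod_cast h2
    rw [h3]
    exact AddSubgroup.mem_zmultiples_iff.mpr ⟨n, by rw [zsmul_one]⟩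
  · -- elements of finite order are roots of unity `exp (2πik/n)`
    obtain ⟨n, hn, hzn⟩ := hz.exists_pow_eq_one
    haveI : NeZero n := ⟨hn.ne'⟩
    have hmem : z ∈ rootsOfUnity n ℂ := (_root_.mem_rootsOfUnity n z).mpr hzn
    obtain ⟨i, -, hi⟩ := (Complex.mem_rootsOfUnity n z).mp hmem
    refine ⟨(((i : ℚ) / n : ℚ) : AddCircle (1 : ℚ)), Units.ext ?_⟩
    show ((Additive.toMul (ē (((i : ℚ) / n : ℚ) : AddCircle (1 : ℚ))) : ℂˣ) : ℂ) = z
    rw [hē, hE, ← hi]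
    push_cast
    rfl

/-! ### §1. Local characters: descent of `χ_v ∘ (W_{F_v} → Γ_{F_v})` along the local Artin map -/

section Local

variable {G : Type*} [Group G] {A : Type*} [AddCommGroup A]

/-- An additive character of a group satisfies `ψ(t⁻¹) = -ψ(t)`. [folklore] -/
private theorem character_apply_inv {ψ : G → A} (hψ : ∀ σ τ, ψ (σ * τ) = ψ σ + ψ τ) (t : G) :
    ψ t⁻¹ = -ψ t := by
  have h := hψ t⁻¹ t
  rw [inv_mul_cancel, character_apply_one hψ] at h
  exact eq_neg_of_add_eq_zero_left h.symm

variable (F : Type*) [Field F] [ValuativeRel F] [TopologicalSpace F] [IsNonarchimedeanLocalField F]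

/-- **Local step.**  A locally constant additive character `χ : Γ_F → ℚ/ℤ` of the absolute Galois
group of a non-archimedean local field `F`, restricted to the Weil group, descends along THE local
Artin map `Art_F : W_F → Fˣ` (`canonicalArtin F`: an open quotient map with kernel `closure [W_F, W_F]`,
`isLocalArtinMap_canonicalArtin_holds`) to a locally constant additive character `χ' : Fˣ → ℚ/ℤ` with
`χ' ∘ Art_F = χ|_{W_F}` — the local reciprocity isomorphism on characters of finite order («the
reciprocity map induces a topological isomorphism of the profinite completion of `F_vˣ` with
`Γ_{F_v}^{ab}`», transport clause of the fact's docstring).  The values of `χ'` are values of `χ`.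
[cite: CasselsFrohlichANT1967, Ch. VI §2.1–2.3 (Serre, the reciprocity map)]
[cite: ClozelHarrisTaylor2008, Lemma 4.1.1 (p. 116)] -/
theorem exists_character_comp_canonicalArtin (χ : absoluteGaloisGroup F → AddCircle (1 : ℚ))
    (hlc : IsLocallyConstant χ) (hadd : ∀ σ τ, χ (σ * τ) = χ σ + χ τ) :
    ∃ χ' : Fˣ → AddCircle (1 : ℚ), IsLocallyConstant χ' ∧ (∀ x y, χ' (x * y) = χ' x + χ' y) ∧
      Set.range χ' ⊆ Set.range χ ∧
      ∀ w : WeilGroup F, χ' (canonicalArtin F w) = χ (WeilGroup.toAbsGalois F w) := by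
  have ha := isLocalArtinMap_canonicalArtin_holds F
  haveI : IsTopologicalGroup (WeilGroup F) := WeilGroup.isTopologicalGroup_holds F
  have hsurj : Function.Surjective (canonicalArtin F) := ha.isOpenQuotientMap_artin.surjective
  -- `χ ∘ (W_F → Γ_F)` is a locally constant additive character of `W_F`
  set χW : WeilGroup F → AddCircle (1 : ℚ) := fun w => χ (WeilGroup.toAbsGalois F w) with hχW
  have hlcW : IsLocallyConstant χW := hlc.comp_continuous (WeilGroup.continuous_toAbsGalois' (F := F))
  have haddW : ∀ w w' : WeilGroup F, χW (w * w') = χW w + χW w' := fun w w' => by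
    simp only [hχW, map_mul, hadd]
  -- it kills `ker Art_F = closure [W_F, W_F]`
  have hker : ∀ k : WeilGroup F, canonicalArtin F k = 1 → χW k = 0 := by
    intro k hk
    have hk' : k ∈ (commutator (WeilGroup F)).topologicalClosure := by
      rw [← SetLike.mem_coe, Subgroup.topologicalClosure_coe, ← ha.ker_artin, SetLike.mem_coe,
        MonoidHom.mem_ker]
      exact hk
    exact character_apply_eq_zero_of_mem_closure_commutator hlcW haddW hk'
  -- hence is constant on the fibres of `Art_F`
  have hfib : ∀ w w' : WeilGroup F, canonicalArtin F w = canonicalArtin F w' → χW w = χW w' := by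
    intro w w' h
    have h1 : canonicalArtin F (w⁻¹ * w') = 1 := by rw [map_mul, map_inv, h, inv_mul_cancel]
    have h2 := hker _ h1
    rw [haddW, character_apply_inv haddW, neg_add_eq_zero] at h2
    exact h2
  -- the descended character
  refine ⟨fun x => χW (Function.surjInv hsurj x), ?_, fun x y => ?_, ?_, fun w => ?_⟩
  · -- locally constant: fibres are images under the open map `Art_F` of fibres of `χW`
    intro s
    have hs : (fun x => χW (Function.surjInv hsurj x)) ⁻¹' s = canonicalArtin F '' (χW ⁻¹' s) := by
      ext x
      simp only [Set.mem_preimage, Set.mem_image]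
      constructor
      · intro hx
        exact ⟨Function.surjInv hsurj x, hx, Function.surjInv_eq hsurj x⟩
      · rintro ⟨w, hw, rfl⟩
        rwa [hfib _ w (Function.surjInv_eq hsurj (canonicalArtin F w))]
    rw [hs]
    exact ha.isOpenQuotientMap_artin.isOpenMap _ (hlcW s)
  · -- additive
    obtain ⟨w, rfl⟩ := hsurj x
    obtain ⟨w', rfl⟩ := hsurj y
    show χW (Function.surjInv hsurj (canonicalArtin F w * canonicalArtin F w')) =
      χW (Function.surjInv hsurj (canonicalArtin F w)) + χW (Function.surjInv hsurj (canonicalArtin F w'))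
    rw [hfib _ w (Function.surjInv_eq hsurj _), hfib _ w' (Function.surjInv_eq hsurj _), ← map_mul,
      hfib _ (w * w') (Function.surjInv_eq hsurj _), haddW]
  · -- values
    rintro _ ⟨x, rfl⟩
    exact ⟨_, rfl⟩
  · -- `χ' (Art_F w) = χ w`
    exact hfib _ w (Function.surjInv_eq hsurj _)

/-- On a compact group (e.g. `Γ_{F_v}` for `F_v` of characteristic `0`) a locally constant character
has finitely many values, so some `m ≥ 1` kills all of them. [folklore] -/
private theorem exists_nsmul_eq_zero_of_isLocallyConstant {X : Type*} [TopologicalSpace X]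
    [CompactSpace X] (χ : X → AddCircle (1 : ℚ)) (hlc : IsLocallyConstant χ) :
    ∃ m : ℕ, 0 < m ∧ ∀ c ∈ Set.range χ, m • c = 0 := by
  classical
  have hfin : (Set.range χ).Finite := hlc.range_finite
  -- every element of `ℚ/ℤ` has finite order
  have hord : ∀ c : AddCircle (1 : ℚ), IsOfFinAddOrder c := by
    intro c
    induction c using QuotientAddGroup.induction_on with
    | H q =>
    refine isOfFinAddOrder_iff_nsmul_eq_zero.mpr ⟨q.den, q.den_pos, ?_⟩
    rw [← QuotientAddGroup.mk_nsmul, QuotientAddGroup.eq_zero_iff]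
    refine AddSubgroup.mem_zmultiples_iff.mpr ⟨q.num, ?_⟩
    rw [zsmul_one, nsmul_eq_mul, Rat.den_mul_eq_num]
  refine ⟨∏ c ∈ hfin.toFinset, addOrderOf c, Finset.prod_pos fun c _ => (hord c).addOrderOf_pos,
    fun c hc => ?_⟩
  exact addOrderOf_dvd_iff_nsmul_eq_zero.mp
    (Finset.dvd_prod_of_mem _ (hfin.mem_toFinset.mpr hc))

end Local

/-! ### §2. Global units: «any finite index subgroup of the units is a congruence subgroup»
(Chevalley 1951 Thm. 1 for the `S`-units, `Chevalley1951.thm1_holds`) -/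

section Units

/-- Splitting a natural number `n ≠ 0` as `g · c` with `c` prime to `a` and `g ∣ a^k`. [folklore] -/
private theorem nat_exists_eq_mul_coprime_dvd_pow (n a : ℕ) (hn : 0 < n) :
    ∃ g c k : ℕ, n = g * c ∧ c.Coprime a ∧ g ∣ a ^ k := by
  induction n using Nat.recOnPosPrimePosCoprime with
  | zero => exact absurd hn (lt_irrefl 0)
  | one => exact ⟨1, 1, 0, rfl, Nat.coprime_one_left a, by rw [pow_zero]⟩
  | prime_pow p e hp _ =>
    by_cases hpa : p ∣ a
    · exact ⟨p ^ e, 1, e, (mul_one _).symm, Nat.coprime_one_left a, pow_dvd_pow_of_dvd hpa e⟩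
    · exact ⟨1, p ^ e, 0, (one_mul _).symm,
        Nat.Coprime.pow_left e ((Nat.Prime.coprime_iff_not_dvd hp).mpr hpa), one_dvd _⟩
  | coprime A B hA hB _ ihA ihB =>
    obtain ⟨g₁, c₁, k₁, h₁, hc₁, hg₁⟩ := ihA (by omega)
    obtain ⟨g₂, c₂, k₂, h₂, hc₂, hg₂⟩ := ihB (by omega)
    exact ⟨g₁ * g₂, c₁ * c₂, k₁ + k₂, by rw [h₁, h₂]; ring, Nat.Coprime.mul_left hc₁ hc₂,
      by rw [pow_add]; exact mul_dvd_mul hg₁ hg₂⟩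

variable {F : Type} [Field F] [NumberField F]

/-- **From local congruences to Hasse's multiplicative congruence.**  If `|x − 1|_𝔭 ≤ |a|_𝔭` at every
prime `𝔭 ∋ a` of the number field `F` (`x ∈ F`, `a ≥ 1` a rational integer), then `x ≡ 1 (mod a)` in
the sense of Hasse–Chevalley: `x − 1 = a·y/z` with `y, z` integers of `F` and `z ≠ 0` prime to `a`
(the hypothesis shape of `Chevalley1951.thm1`).  Proof: `(x − 1)/a = b/n` with `b ∈ 𝓞_F`, `n ∈ ℕ`;
split `n = g·c`, `(c, a) = 1`, `g ∣ a^k`; then `b/g` is integral at every prime (at the primes of `g`,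
which contain `a`, because `(x−1)/a` is), and `x − 1 = a·(b/g)/c`.
[cite: ChevalleyDeuxTheoremes1951, Thm 1 (p. 36), «congruences multiplicatives de Hasse»] -/
theorem exists_hasse_of_valuation_sub_one_le (x : F) {a : ℕ} (ha : 0 < a)
    (h : ∀ v : HeightOneSpectrum (𝓞 F), (a : 𝓞 F) ∈ v.asIdeal →
      v.valuation F (x - 1) ≤ v.valuation F ((a : 𝓞 F) : F)) :
    ∃ y z : 𝓞 F, (z : F) ≠ 0 ∧ IsCoprime z (a : 𝓞 F) ∧ x - 1 = (a : F) * (y : F) / (z : F) := by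
  classical
  have haF : ((a : 𝓞 F) : F) = (a : F) := by norm_cast
  have ha0 : (a : F) ≠ 0 := by exact_mod_cast ha.ne'
  set t : F := (x - 1) / (a : F) with ht
  have hxt : x - 1 = (a : F) * t := by rw [ht, mul_div_cancel₀ _ ha0]
  -- `t = p / q` with `p, q ∈ 𝓞 F`, then an integer denominator `n = N(q)`
  obtain ⟨p, q, hq, hpq⟩ := IsFractionRing.div_surjective (A := 𝓞 F) t
  have hq0 : q ≠ 0 := nonZeroDivisors.ne_zero hq
  have hq0' : (q : F) ≠ 0 := by
    rw [Ne, ← map_zero (algebraMap (𝓞 F) F)]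
    exact fun e => hq0 (IsFractionRing.injective (𝓞 F) F e)
  set n : ℕ := Ideal.absNorm (Ideal.span {q}) with hn
  have hn0 : 0 < n := by
    refine Nat.pos_of_ne_zero fun h0 => hq0 ?_
    rwa [hn, Ideal.absNorm_eq_zero_iff, Ideal.span_singleton_eq_bot] at h0
  obtain ⟨q', hq'⟩ : ∃ q' : 𝓞 F, q' * q = n := Ideal.mem_span_singleton'.mp (Ideal.absNorm_mem _)
  have hnF : (n : F) = ((q' * q : 𝓞 F) : F) := by rw [hq']; norm_cast
  -- `n t = p q' ∈ 𝓞 F`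
  have hb : (n : F) * t = ((p * q' : 𝓞 F) : F) := by
    rw [← hpq, hnF]
    change ((q' * q : 𝓞 F) : F) * ((p : F) / (q : F)) = ((p * q' : 𝓞 F) : F)
    push_cast
    field_simp
  obtain ⟨g, c, k, hngc, hca, hgk⟩ := nat_exists_eq_mul_coprime_dvd_pow n a hn0
  have hg0 : (g : F) ≠ 0 := by
    have : g ≠ 0 := fun h0 => by rw [h0, zero_mul] at hngc; omega
    exact_mod_cast this
  have hc0 : (c : F) ≠ 0 := by
    have : c ≠ 0 := fun h0 => by rw [h0, mul_zero] at hngc; omega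
    exact_mod_cast this
  -- `y := n t / g` is integral at every prime
  have hy : ∀ v : HeightOneSpectrum (𝓞 F), v.valuation F (((p * q' : 𝓞 F) : F) / (g : F)) ≤ 1 := by
    intro v
    by_cases hgv : ((g : 𝓞 F)) ∈ v.asIdeal
    · -- then `a ∈ 𝔭_v`, so `t` is `v`-integral, and `n t / g = c t`
      have hav : (a : 𝓞 F) ∈ v.asIdeal := by
        obtain ⟨d, hd⟩ := hgk
        have hak : ((a : 𝓞 F)) ^ k = (g : 𝓞 F) * (d : 𝓞 F) := by exact_mod_cast hd
        exact v.isPrime.mem_of_pow_mem k (hak ▸ v.asIdeal.mul_mem_right _ hgv)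
      have ht1 : v.valuation F t ≤ 1 := by
        rw [ht, map_div₀, ← haF]
        exact div_le_one_of_le₀ (h v hav) zero_le
      have e : ((p * q' : 𝓞 F) : F) / (g : F) = (c : F) * t := by
        rw [← hb, hngc]; push_cast; field_simp
      have hc1 : v.valuation F (c : F) ≤ 1 := by
        have := v.valuation_le_one (K := F) (c : 𝓞 F)
        push_cast at this
        exact this
      rw [e, map_mul]
      calc v.valuation F (c : F) * v.valuation F t ≤ 1 * 1 := mul_le_mul' hc1 ht1
        _ = 1 := one_mul 1
    · have hg1 : v.valuation F ((g : 𝓞 F) : F) = 1 := v.valuation_eq_one_iff_notMem.mpr hgv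
      push_cast at hg1
      rw [map_div₀, hg1, div_one]
      exact v.valuation_le_one _
  obtain ⟨y, hyF⟩ := HeightOneSpectrum.mem_integers_of_valuation_le_one F _ hy
  refine ⟨y, c, by push_cast; exact hc0, hca.cast, ?_⟩
  -- `x - 1 = a t = a (y / c)` since `y / c = n t / (g c) = t`
  have hyc : (y : F) / ((c : 𝓞 F) : F) = t := by
    change algebraMap (𝓞 F) F y / _ = t
    rw [hyF, div_div, show ((c : 𝓞 F) : F) = (c : F) by norm_cast,
      show (g : F) * (c : F) = (n : F) by rw [hngc]; push_cast; ring,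
      div_eq_iff (by exact_mod_cast hn0.ne' : (n : F) ≠ 0), mul_comm t (n : F)]
    exact hb.symm
  rw [mul_div_assoc, hyc, hxt]

/-- **Chevalley's theorem applied to a character of the `S`-units.**  Let `S` be a finite set of
primes of the number field `F` and `f : Fˣ → ℚ/ℤ` an additive character killed by `m ≥ 1` on the
`S`-units `E` (a finitely generated group, Dirichlet–Chevalley–Hasse).  Then there is a rational
integer `a ≥ 1` lying in no prime of `S` such that every `S`-unit `b` with `|b − 1|_𝔭 ≤ |a|_𝔭` at the
primes `𝔭 ∋ a` satisfies `f(b) = 0`: by Chevalley's Théorème 1 (`Chevalley1951.thm1_holds`, with `N`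
the product of the norms of the primes in `S`) such a `b` is an `m`-th power in `E`.  This is the
printed «we choose an open subgroup `U ⊂ (A_F^S)×` such that `χ_S` is trivial on `U ∩ F×` (this is
possible as any finite index subgroup of `O_F×` is a congruence subgroup)».
[cite: ClozelHarrisTaylor2008, Lemma 4.1.1 (p. 116), proof]
[cite: ChevalleyDeuxTheoremes1951, Thm 1 (p. 36)] -/
theorem exists_modulus_sUnit_character (S : Finset (HeightOneSpectrum (𝓞 F)))
    (f : Fˣ → AddCircle (1 : ℚ)) (hf : ∀ x y, f (x * y) = f x + f y) {m : ℕ} (hm : 0 < m)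
    (hfm : ∀ x ∈ (S : Set (HeightOneSpectrum (𝓞 F))).unit F, m • f x = 0) :
    ∃ a : ℕ, 0 < a ∧ (∀ v ∈ S, (a : 𝓞 F) ∉ v.asIdeal) ∧
      ∀ b : Fˣ, b ∈ (S : Set (HeightOneSpectrum (𝓞 F))).unit F →
        (∀ v : HeightOneSpectrum (𝓞 F), (a : 𝓞 F) ∈ v.asIdeal →
          v.valuation F ((b : F) - 1) ≤ v.valuation F ((a : 𝓞 F) : F)) → f b = 0 := by
  classical
  set E : Subgroup Fˣ := (S : Set (HeightOneSpectrum (𝓞 F))).unit F with hEdef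
  haveI : Finite (S : Set (HeightOneSpectrum (𝓞 F))) := S.finite_toSet.to_subtype
  have hE : E.FG := (Group.fg_iff_subgroup_fg E).mp inferInstance
  set N : ℕ := ∏ v ∈ S, Ideal.absNorm v.asIdeal with hNdef
  have hN : 0 < N := Finset.prod_pos fun v _ =>
    Nat.pos_of_ne_zero fun h0 => v.ne_bot (Ideal.absNorm_eq_zero_iff.mp h0)
  obtain ⟨a, ha0, haN, hCh⟩ := NumberFields.Chevalley1951.thm1_holds F E hE m hm N hN
  refine ⟨a, ha0, fun v hv hav => ?_, fun b hb hcong => ?_⟩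
  · -- `a ∈ 𝔭_v` would make `N𝔭_v` a common divisor of `a^d` and `N`
    have h1 : Ideal.absNorm v.asIdeal ∣ a ^ Module.finrank ℤ (𝓞 F) := by
      have hd := Ideal.absNorm_dvd_absNorm_of_le ((Ideal.span_singleton_le_iff_mem _).mpr hav)
      rwa [Ideal.absNorm_span_singleton, show ((a : 𝓞 F)) = algebraMap ℤ (𝓞 F) (a : ℤ) by simp,
        Algebra.norm_algebraMap, Int.natAbs_pow, Int.natAbs_natCast] at hd
    have h2 : Ideal.absNorm v.asIdeal ∣ N := Finset.dvd_prod_of_mem _ hv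
    have h3 : Ideal.absNorm v.asIdeal = 1 :=
      Nat.Coprime.eq_one_of_dvd (Nat.Coprime.coprime_dvd_left h1 (Nat.Coprime.pow_left _ haN)) h2
    exact v.isPrime.ne_top (Ideal.absNorm_eq_one_iff.mp h3)
  · obtain ⟨y, z, hz0, hzc, hxyz⟩ := exists_hasse_of_valuation_sub_one_le (b : F) ha0 hcong
    obtain ⟨w, hwE, hbw⟩ := hCh b hb ⟨y, z, hz0, hzc, hxyz⟩
    rw [hbw, character_apply_pow hf, hfm w hwE]

end Units

/-! ### §3. Idèles: the finite-order Hecke character with prescribed component at `v₀` -/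

section Ideles

/-- **Descent and extension of `ℚ/ℤ`-valued characters.**  An additive character `c` of a group
`G`, trivial on the kernel of a homomorphism `g : G → Q` to a commutative group, is the pull-back of an
additive character of `Q`: descend to `g(G)` and extend from `g(G)` to `Q` (`ℚ/ℤ` is divisible, i.e. an
injective `ℤ`-module — Mathlib's `CharacterModule.dual_surjective_of_injective`).  This is the printed
«extend `χ_S` to `U∏F_v×/(U ∩ F×)` … Finally we can extend this character to `A_F×/F×`».
[cite: ClozelHarrisTaylor2008, Lemma 4.1.1 (p. 116), proof] -/
theorem exists_character_comp_eq {G Q : Type*} [Group G] [CommGroup Q] (g : G →* Q)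
    (c : G → AddCircle (1 : ℚ)) (hc : ∀ x y, c (x * y) = c x + c y)
    (hker : ∀ x, g x = 1 → c x = 0) :
    ∃ φ : Q → AddCircle (1 : ℚ), (∀ x y, φ (x * y) = φ x + φ y) ∧ ∀ x, φ (g x) = c x := by
  let gA : Additive G →+ Additive Q := MonoidHom.toAdditive g
  let cA : Additive G →+ AddCircle (1 : ℚ) :=
    { toFun := fun x => c x.toMul
      map_zero' := character_apply_one hc
      map_add' := fun x y => hc x.toMul y.toMul }
  have hkerle : gA.rangeRestrict.ker ≤ cA.ker := by
    intro x hx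
    rw [AddMonoidHom.mem_ker] at hx ⊢
    have hx' : gA x = 0 := by
      have := congrArg Subtype.val hx
      rwa [AddMonoidHom.coe_rangeRestrict] at this
    exact hker x.toMul hx'
  -- descent to `g(G)`
  let c₁ : gA.range →+ AddCircle (1 : ℚ) :=
    gA.rangeRestrict.liftOfSurjective gA.rangeRestrict_surjective ⟨cA, hkerle⟩
  have hc₁ : ∀ x, c₁ (gA.rangeRestrict x) = cA x := fun x =>
    gA.rangeRestrict.liftOfRightInverse_comp_apply _ _ _ x
  -- extension to `Q`
  obtain ⟨φ₀, hφ₀⟩ := CharacterModule.dual_surjective_of_injective (R := ℤ)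
    gA.range.subtype.toIntLinearMap gA.range.subtype_injective c₁
  refine ⟨fun y => φ₀ (Additive.ofMul y), fun x y => ?_, fun x => ?_⟩
  · change φ₀ (Additive.ofMul x + Additive.ofMul y) = _
    rw [map_add]
  · have h1 := DFunLike.congr_fun hφ₀ (gA.rangeRestrict (Additive.ofMul x))
    rw [CharacterModule.dual_apply] at h1
    -- `h1 : φ₀ (subtype (rangeRestrict x)) = c₁ (rangeRestrict x)`
    have h2 : (c₁ : gA.range → AddCircle (1 : ℚ)) (gA.rangeRestrict (Additive.ofMul x)) =
        cA (Additive.ofMul x) := hc₁ _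
    exact h1.trans h2

variable {F : Type} [Field F] [NumberField F]

/-- `|a|_v = q_v^{-n_v}` for a rational integer `a ≥ 1`, `n_v` the multiplicity of `𝔭_v` in `(a)`.
[folklore] -/
private theorem valued_natCast_eq_exp_neg (v : HeightOneSpectrum (𝓞 F)) {a : ℕ} (ha : 0 < a) :
    Valued.v (algebraMap F (v.adicCompletion F) ((a : 𝓞 F) : F)) =
      WithZero.exp (-(modulusExp (Ideal.span {(a : 𝓞 F)}) v : ℤ)) := by
  rw [valued_algebraMap_adicCompletion, HeightOneSpectrum.valuation_of_algebraMap,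
    v.intValuation_if_neg (by exact_mod_cast ha.ne' : (a : 𝓞 F) ≠ 0)]
  rfl

/-- **Idelic step.**  Let `S` be a finite set of primes of the number field `F`, `v₀ ∈ S`, and
`χ' : F_{v₀}ˣ → ℚ/ℤ` a locally constant additive character killed by some `m ≥ 1`.  Then there is a
Hecke character `θ` of finite order with local component `θ_{v₀} = e ∘ χ'` and `θ_v = 1` at the other
places of `S` (`e : ℚ/ℤ → ℂˣ` any additive-to-multiplicative map).  This is the printed proof of
Lemma 4.1.1: with `a` from Chevalley's theorem (§2; `a` prime to `S`, killing `χ'` on the `S`-units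
`≡ 1 (mod a)`) let `U ≤ 𝕀_F` be the open subgroup «unit and `≡ 1 (mod a)` at the finite `v ∉ S`,
in `ker χ'` at `v₀`» and `Ñ = Fˣ·U` (open, hence of finite index — Tate's remark after VII 5.1 (D));
`χ'` is trivial on the kernel of `F_{v₀}ˣ → 𝕀_F/Ñ` («`χ_S` is trivial on `U ∩ F×`»), so it descends and
extends to a character `φ₀` of the finite group `𝕀_F/Ñ`, and `θ = e ∘ φ₀ ∘ (𝕀_F → 𝕀_F/Ñ)`
(`heckeOfIdeleQuotientChar`). [cite: ClozelHarrisTaylor2008, Lemma 4.1.1 (p. 116), proof]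
[cite: CasselsFrohlichANT1967, Ch. VII §5.1, remark after (D) (PDF p. 213)] -/
theorem exists_heckeCharacter_localComponent (S : Finset (HeightOneSpectrum (𝓞 F)))
    {v₀ : HeightOneSpectrum (𝓞 F)} (hv₀ : v₀ ∈ S)
    (χ' : (v₀.adicCompletion F)ˣ → AddCircle (1 : ℚ)) (hlc : IsLocallyConstant χ')
    (hadd : ∀ x y, χ' (x * y) = χ' x + χ' y) {m : ℕ} (hm : 0 < m) (hχm : ∀ x, m • χ' x = 0)
    (e : AddCircle (1 : ℚ) → ℂˣ) (he0 : e 0 = 1) (he : ∀ x y, e (x + y) = e x * e y) :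
    ∃ θ : HeckeCharacter F, θ.IsFiniteOrder ∧ (∀ x, θ (localUnits v₀ x) = e (χ' x)) ∧
      ∀ v ∈ S, v ≠ v₀ → ∀ x, θ (localUnits v x) = 1 := by
  classical
  -- §2 applied to `f = χ' ∘ (Fˣ → F_{v₀}ˣ)`
  set f : Fˣ → AddCircle (1 : ℚ) := fun b => χ' (globalToLocalUnits v₀ b) with hf
  have hfadd : ∀ x y, f (x * y) = f x + f y := fun x y => by simp only [hf, map_mul, hadd]
  obtain ⟨a, ha0, haS, hker⟩ := exists_modulus_sUnit_character S f hfadd hm (fun x _ => hχm _)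
  set 𝔞 : Ideal (𝓞 F) := Ideal.span {(a : 𝓞 F)} with h𝔞def
  have h𝔞 : 𝔞 ≠ ⊥ := by
    rw [h𝔞def, Ne, Ideal.span_singleton_eq_bot]; exact_mod_cast ha0.ne'
  -- the component at `v₀` as a homomorphism `𝕀_F → F_{v₀}ˣ`
  let cpt : ideleGroup F →* (v₀.adicCompletion F)ˣ :=
    { toFun := fun x => Units.mk0 ((x : AdeleRing (𝓞 F) F).2 v₀) (ideleGroup_snd_ne_zero x v₀)
      map_one' := Units.ext rfl
      map_mul' := fun x y => Units.ext (ideleGroup_val_snd_mul x y v₀) }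
  have hcpt : ∀ x, ((cpt x : (v₀.adicCompletion F)ˣ) : v₀.adicCompletion F) =
      (x : AdeleRing (𝓞 F) F).2 v₀ := fun _ => rfl
  have hcpt_cont : Continuous cpt := by
    refine Units.continuous_iff.mpr ⟨continuous_ideleGroup_snd_apply v₀, ?_⟩
    have h : (fun x : ideleGroup F => ((cpt x)⁻¹ : (v₀.adicCompletion F)ˣ).val) =
        fun x => ((x⁻¹ : ideleGroup F) : AdeleRing (𝓞 F) F).2 v₀ := by
      ext x; rw [← map_inv]; rfl
    rw [h]
    exact (continuous_ideleGroup_snd_apply v₀).comp continuous_inv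
  have hcpt_self : ∀ x, cpt (localUnits v₀ x) = x := fun x =>
    Units.ext (localUnits_snd_apply_self v₀ x)
  have hcpt_ne : ∀ v, v ≠ v₀ → ∀ x, cpt (localUnits v x) = 1 := fun v hv x =>
    Units.ext (localUnits_snd_apply_of_ne x (Ne.symm hv))
  have hcpt_principal : ∀ b : Fˣ, cpt (principalIdele F b) = globalToLocalUnits v₀ b := fun b =>
    Units.ext (by rw [hcpt, principalIdele_snd, val_globalToLocalUnits])
  -- `U₁`: unit and `≡ 1 (mod a)` at the finite places outside `S`
  obtain ⟨U₁, hU₁⟩ : ∃ U₁ : Subgroup (ideleGroup F), ∀ x, x ∈ U₁ ↔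
      ∀ v, v ∉ S → Valued.v ((x : AdeleRing (𝓞 F) F).2 v) = 1 ∧
        Valued.v ((x : AdeleRing (𝓞 F) F).2 v - 1) ≤ WithZero.exp (-(modulusExp 𝔞 v : ℤ)) := by
    refine ⟨{ carrier := (setOf fun x => ∀ v, v ∉ S → Valued.v ((x : AdeleRing (𝓞 F) F).2 v) = 1 ∧
                  Valued.v ((x : AdeleRing (𝓞 F) F).2 v - 1) ≤ WithZero.exp (-(modulusExp 𝔞 v : ℤ))),
              one_mem' := fun v _ => ⟨(unitIdeles F).one_mem v, by
                have h1 : (((1 : ideleGroup F) : AdeleRing (𝓞 F) F).2 v) = 1 := rfl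
                rw [h1, sub_self, map_zero]; exact zero_le⟩,
              mul_mem' := fun {x y} hx hy v hv => ?_,
              inv_mem' := fun {x} hx v hv => ?_ }, fun _ => Iff.rfl⟩
    · obtain ⟨hx1, hx2⟩ := hx v hv
      obtain ⟨hy1, hy2⟩ := hy v hv
      refine ⟨by rw [ideleGroup_val_snd_mul, map_mul, hx1, hy1, mul_one], ?_⟩
      rw [ideleGroup_val_snd_mul]
      set c := (x : AdeleRing (𝓞 F) F).2 v
      set d := (y : AdeleRing (𝓞 F) F).2 v
      have e1 : c * d - 1 = (c - 1) * d + (d - 1) := by ring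
      rw [e1]
      refine (Valuation.map_add _ _ _).trans (max_le ?_ hy2)
      rw [map_mul, hy1, mul_one]; exact hx2
    · obtain ⟨hx1, hx2⟩ := hx v hv
      rw [ideleGroup_val_inv_snd]
      set c := (x : AdeleRing (𝓞 F) F).2 v
      have hc0 : c ≠ 0 := ideleGroup_snd_ne_zero x v
      refine ⟨by rw [map_inv₀, hx1, inv_one], ?_⟩
      calc Valued.v (c⁻¹ - 1) = Valued.v (c⁻¹ * (1 - c)) := by
            rw [mul_sub, mul_one, inv_mul_cancel₀ hc0]
        _ = Valued.v (c - 1) := by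
            rw [map_mul, map_inv₀, hx1, inv_one, one_mul, Valuation.map_sub_swap]
        _ ≤ _ := hx2
  -- `U₂`: the kernel of `χ'` at `v₀`
  obtain ⟨K₀, hK₀⟩ : ∃ K₀ : Subgroup (v₀.adicCompletion F)ˣ, ∀ u, u ∈ K₀ ↔ χ' u = 0 := by
    refine ⟨{ carrier := (setOf fun u => χ' u = 0),
              one_mem' := character_apply_one hadd,
              mul_mem' := fun {u u'} hu hu' => ?_,
              inv_mem' := fun {u} hu => ?_ }, fun _ => Iff.rfl⟩
    · change χ' (u * u') = 0
      rw [hadd, hu, hu', add_zero]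
    · change χ' u⁻¹ = 0
      rw [character_apply_inv hadd, hu, neg_zero]
  set U : Subgroup (ideleGroup F) := U₁ ⊓ K₀.comap cpt with hUdef
  have hU : ∀ x, x ∈ U ↔ x ∈ U₁ ∧ χ' (cpt x) = 0 := fun x => by
    rw [hUdef, Subgroup.mem_inf, Subgroup.mem_comap, hK₀]
  -- `U` is open
  have hU₁o : IsOpen (U₁ : Set (ideleGroup F)) := by
    refine U₁.isOpen_of_mem_nhds (g := 1) (Filter.mem_of_superset
      (Filter.inter_mem (congruenceIdeles_mem_nhds_one h𝔞)
        ((isOpen_unitIdeles F).mem_nhds (unitIdeles F).one_mem)) ?_)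
    rintro x ⟨hx1, hx2⟩
    rw [SetLike.mem_coe, mem_congruenceIdeles_iff] at hx1
    rw [SetLike.mem_coe, mem_unitIdeles_iff] at hx2
    rw [SetLike.mem_coe, hU₁]
    intro v hv
    refine ⟨hx2 v, ?_⟩
    by_cases hm0 : modulusExp 𝔞 v = 0
    · rw [hm0, Nat.cast_zero, neg_zero, WithZero.exp_zero]
      refine (Valuation.map_sub _ _ _).trans (max_le (hx2 v).le ?_)
      rw [map_one]
    · exact hx1.1 v hm0
  have hUo : IsOpen (U : Set (ideleGroup F)) := by
    rw [hUdef, Subgroup.coe_inf]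
    refine hU₁o.inter ?_
    have h : ((K₀.comap cpt : Subgroup (ideleGroup F)) : Set (ideleGroup F)) = cpt ⁻¹' (χ' ⁻¹' {0}) := by
      ext x
      rw [SetLike.mem_coe, Subgroup.mem_comap, hK₀, Set.mem_preimage, Set.mem_preimage,
        Set.mem_singleton_iff]
    rw [h]
    exact (hlc.isOpen_fiber 0).preimage hcpt_cont
  -- `Ñ = Fˣ · U`, open of finite index
  set Ñ : Subgroup (ideleGroup F) := principalIdeles F ⊔ U with hÑdef
  have hP : principalIdeles F ≤ Ñ := le_sup_left
  have hÑo : IsOpen (Ñ : Set (ideleGroup F)) := Subgroup.isOpen_mono le_sup_right hUo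
  haveI : Ñ.FiniteIndex := NumberFields.finiteIndex_of_isOpen_of_principalIdeles_le Ñ hÑo hP
  -- local ideles at the places of `S` other than `v₀` lie in `U`
  have hlocU : ∀ v ∈ S, v ≠ v₀ → ∀ x, localUnits v x ∈ U := by
    intro v hv hne x
    rw [hU, hU₁]
    refine ⟨fun w hw => ?_, by rw [hcpt_ne v hne, character_apply_one hadd]⟩
    have hwv : w ≠ v := fun h => hw (h ▸ hv)
    rw [localUnits_snd_apply_of_ne x hwv, map_one, sub_self, map_zero]
    exact ⟨rfl, zero_le⟩
  -- `χ'` is trivial on the kernel of `g : F_{v₀}ˣ → 𝕀_F/Ñ`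
  set g : (v₀.adicCompletion F)ˣ →* ideleGroup F ⧸ Ñ := (QuotientGroup.mk' Ñ).comp (localUnits v₀)
    with hgdef
  have hgker : ∀ x, g x = 1 → χ' x = 0 := by
    intro x hx
    rw [hgdef, MonoidHom.comp_apply, QuotientGroup.mk'_apply, QuotientGroup.eq_one_iff, hÑdef] at hx
    obtain ⟨y, hy, z, hz, hyz⟩ := Subgroup.mem_sup.mp hx
    obtain ⟨b, rfl⟩ := hy
    change principalIdele F b * z = localUnits v₀ x at hyz
    have hbz : principalIdele F b = localUnits v₀ x * z⁻¹ := by rw [← hyz, mul_inv_cancel_right]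
    have hzU := (hU z⁻¹).mp (U.inv_mem hz)
    -- `b` is an `S`-unit, `≡ 1 (mod a)`
    have hbS : b ∈ (S : Set (HeightOneSpectrum (𝓞 F))).unit F := by
      intro w hw
      have hw' : w ∉ S := hw
      have hwv : w ≠ v₀ := fun h => hw' (h ▸ hv₀)
      have h1 := ((hU₁ _).mp hzU.1 w hw').1
      rw [← valued_algebraMap_adicCompletion, ← principalIdele_snd, hbz, ideleGroup_val_snd_mul,
        localUnits_snd_apply_of_ne x hwv, one_mul]
      exact h1
    have hbcong : ∀ w : HeightOneSpectrum (𝓞 F), (a : 𝓞 F) ∈ w.asIdeal →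
        w.valuation F ((b : F) - 1) ≤ w.valuation F ((a : 𝓞 F) : F) := by
      intro w hw
      have hw' : w ∉ S := fun h => haS w h hw
      have hwv : w ≠ v₀ := fun h => hw' (h ▸ hv₀)
      have h2 := ((hU₁ _).mp hzU.1 w hw').2
      rw [← valued_algebraMap_adicCompletion, ← valued_algebraMap_adicCompletion,
        valued_natCast_eq_exp_neg w ha0, map_sub, map_one, ← principalIdele_snd, hbz,
        ideleGroup_val_snd_mul, localUnits_snd_apply_of_ne x hwv, one_mul]
      exact h2
    have hfb : f b = 0 := hker b hbS hbcong
    -- at `v₀`: `x = b · z_{v₀}` with `χ'(z_{v₀}) = 0`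
    have hx0 : x = globalToLocalUnits v₀ b * cpt z := by
      rw [← hcpt_principal, ← map_mul, hyz, hcpt_self]
    have hz0 : χ' (cpt z) = 0 := ((hU z).mp hz).2
    rw [hx0, hadd, hz0, add_zero]
    exact hfb
  -- descend and extend `χ'` to a character `φ₀` of `𝕀_F/Ñ`, and exponentiate
  obtain ⟨φ₀, hφ₀add, hφ₀g⟩ :
      ∃ φ : ideleGroup F ⧸ Ñ → AddCircle (1 : ℚ), (∀ x y, φ (x * y) = φ x + φ y) ∧ ∀ x, φ (g x) = χ' x := by
    refine exists_character_comp_eq (Q := ideleGroup F ⧸ Ñ) g χ' hadd ?_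
    intro x hx
    exact hgker x hx
  let φ : ideleGroup F ⧸ Ñ →* ℂˣ :=
    { toFun := fun y => e (φ₀ y)
      map_one' := by rw [character_apply_one hφ₀add, he0]
      map_mul' := fun y y' => by rw [hφ₀add, he] }
  refine ⟨heckeOfIdeleQuotientChar Ñ hP hÑo φ, isFiniteOrder_heckeOfIdeleQuotientChar Ñ hP hÑo φ,
    fun x => ?_, fun v hv hne x => ?_⟩
  · rw [heckeOfIdeleQuotientChar_apply]
    change e (φ₀ (g x)) = e (χ' x)
    rw [hφ₀g]
  · have hmem : localUnits v x ∈ Ñ := (le_sup_right : U ≤ Ñ) (hlocU v hv hne x)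
    rw [heckeOfIdeleQuotientChar_apply, (QuotientGroup.eq_one_iff _).mpr hmem, map_one]

end Ideles

/-! ### §4. The Galois side: reciprocity in character form, local–global compatibility, density -/

section Galois

/-- A homomorphism with open kernel is locally constant. [folklore] -/
private theorem isLocallyConstant_of_isOpen_ker {Γ G : Type*} [Group Γ] [TopologicalSpace Γ]
    [ContinuousMul Γ] [Group G] (r : Γ →* G) (h : IsOpen (r.ker : Set Γ)) :
    IsLocallyConstant r := by
  refine (IsLocallyConstant.iff_exists_open r).2 fun σ => ⟨{τ | σ⁻¹ * τ ∈ r.ker}, ?_, ?_, ?_⟩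
  · exact h.preimage (continuous_const_mul σ⁻¹)
  · show σ⁻¹ * σ ∈ r.ker
    rw [inv_mul_cancel]; exact r.ker.one_mem
  · intro τ hτ
    have hτ' : r (σ⁻¹ * τ) = 1 := hτ
    rw [map_mul, map_inv, inv_mul_eq_one] at hτ'
    exact hτ'.symm

variable {F : Type} [Field F] [NumberField F]

/-- **Clozel–Harris–Taylor 2008, Lemma 4.1.1, Galois form, one place at a time.**  For a finite set
`S` of primes of the number field `F`, `v₀ ∈ S`, and a locally constant additive character
`χ : Γ_{F_{v₀}} → ℚ/ℤ`, there is a locally constant additive `ψ : Γ_F → ℚ/ℤ` with `ψ ∘ res_{v₀} = χ`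
and `ψ ∘ res_v = 0` for the other `v ∈ S`.  Proof (the printed one, transported): descend `χ` along
the local Artin map (§1), realise it as the `v₀`-component of a finite-order Hecke character `θ` which
is trivial at the other places of `S` (§2–§3); by the existence theorem in character form `θ = χ_L ∘ ψ_{L|F}`
for a finite abelian `L` and a character `χ_L` of `G(L|F)` (`HeckeCharacter.exists_eq_charHecke_of_isFiniteOrder`),
and `ψ := e⁻¹ ∘ χ_L⁻¹ ∘ r_L` works: on the Weil group `W_{F_v}` this is the local–global compatibility
`ψ_{L|F}(ι_v(Art_v w)) · (res w)|_L = 1` (Neukirch VI (5.6),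
`ArtinLocalGlobal.artinIdeleMap_localUnits_mul_absRestrictNormalHom`), and `W_{F_v}` is dense in
`Γ_{F_v}` (`WeilGroup.denseRange_toAbsGalois_holds`).
[cite: ClozelHarrisTaylor2008, Lemma 4.1.1 (p. 116)] [cite: NeukirchANT1999, Ch. VI §5 Prop. (5.6)]
[cite: CasselsFrohlichANT1967, Ch. VII §5.1 Main Theorem (B), (D) (Tate)] -/
theorem exists_character_restrict_eq_single (S : Finset (HeightOneSpectrum (𝓞 F)))
    {v₀ : HeightOneSpectrum (𝓞 F)} (hv₀ : v₀ ∈ S)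
    (χ : absoluteGaloisGroup (v₀.adicCompletion F) → AddCircle (1 : ℚ)) (hlc : IsLocallyConstant χ)
    (hadd : ∀ σ τ, χ (σ * τ) = χ σ + χ τ) :
    ∃ ψ : absoluteGaloisGroup F → AddCircle (1 : ℚ), IsLocallyConstant ψ ∧
      (∀ σ τ, ψ (σ * τ) = ψ σ + ψ τ) ∧
      (∀ σ, ψ (absGaloisRestrict F (v₀.adicCompletion F) σ) = χ σ) ∧
      ∀ v ∈ S, v ≠ v₀ → ∀ σ, ψ (absGaloisRestrict F (v.adicCompletion F) σ) = 0 := by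
  classical
  obtain ⟨e, he0, he, heinj, hesurj⟩ := exists_addCircle_character
  -- §1 at `v₀`, and an exponent killing the values of `χ`
  obtain ⟨χ', hlc', hadd', hrange, hχ'⟩ :=
    exists_character_comp_canonicalArtin (v₀.adicCompletion F) χ hlc hadd
  haveI : CharZero (v₀.adicCompletion F) :=
    charZero_of_injective_algebraMap (algebraMap F (v₀.adicCompletion F)).injective
  obtain ⟨m, hm, hmχ⟩ := exists_nsmul_eq_zero_of_isLocallyConstant χ hlc
  have hχ'm : ∀ x, m • χ' x = 0 := fun x => hmχ _ (hrange ⟨x, rfl⟩)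
  -- §3: the Hecke character
  obtain ⟨θ, hθfin, hθv₀, hθS⟩ :=
    exists_heckeCharacter_localComponent S hv₀ χ' hlc' hadd' hm hχ'm e he0 he
  -- (HG): `θ = χ_L ∘ ψ_{L|F}`
  obtain ⟨L, hfd, hab, χL, hθL⟩ := θ.exists_eq_charHecke_of_isFiniteOrder hθfin
  haveI := hfd
  haveI := hab
  haveI : NumberField L := NumberField.of_module_finite F L
  -- `k : G(L|F) → ℚ/ℤ` with `e (k g) = χ_L(g)⁻¹`
  have hk : ∀ g : L ≃ₐ[F] L, ∃ q, e q = (χL g)⁻¹ := fun g =>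
    hesurj _ (χL.isOfFinOrder (isOfFinOrder_of_finite g)).inv
  choose k hk using hk
  -- the values on the decomposition groups, tested against `e`
  have key : ∀ (v : HeightOneSpectrum (𝓞 F)) (w : WeilGroup (v.adicCompletion F)),
      e (k (absRestrictNormalHom L (absGaloisRestrict F (v.adicCompletion F)
        (WeilGroup.toAbsGalois (v.adicCompletion F) w)))) =
      θ (localUnits v (canonicalArtin (v.adicCompletion F) w)) := by
    intro v w
    have h := ArtinLocalGlobal.artinIdeleMap_localUnits_mul_absRestrictNormalHom v L
      (isLocalArtinMap_canonicalArtin_holds (v.adicCompletion F)) w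
    rw [mul_eq_one_iff_inv_eq] at h
    rw [hk, ← h, map_inv, inv_inv, apply_artinIdeleMap, ← hθL]
  have dense : ∀ (v : HeightOneSpectrum (𝓞 F)) (B : absoluteGaloisGroup (v.adicCompletion F) → ℂˣ),
      IsLocallyConstant B →
      (∀ w, B (WeilGroup.toAbsGalois _ w) = θ (localUnits v (canonicalArtin _ w))) →
      ∀ σ, e (k (absRestrictNormalHom L (absGaloisRestrict F (v.adicCompletion F) σ))) = B σ := by
    intro v B hB hBW σ
    have hA : IsLocallyConstant (fun σ : absoluteGaloisGroup (v.adicCompletion F) =>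
        e (k (absRestrictNormalHom L (absGaloisRestrict F (v.adicCompletion F) σ)))) :=
      ((isLocallyConstant_of_isOpen_ker _ (isOpen_ker_absRestrictNormalHom L)).comp_continuous
        (absGaloisRestrict F (v.adicCompletion F)).continuous).comp fun g => e (k g)
    have hAB := DenseRange.equalizer (WeilGroup.denseRange_toAbsGalois_holds (v.adicCompletion F))
      hA.continuous hB.continuous (funext fun w => (key v w).trans (hBW w).symm)
    exact congrFun hAB σ
  refine ⟨fun σ => k (absRestrictNormalHom L σ), ?_, fun σ τ => ?_, fun σ => ?_, fun v hv hne σ => ?_⟩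
  · -- locally constant
    exact (isLocallyConstant_of_isOpen_ker _ (isOpen_ker_absRestrictNormalHom L)).comp k
  · -- additive, by injectivity of `e`
    apply heinj
    rw [he, hk, hk, hk, map_mul, map_mul, mul_inv]
  · -- at `v₀`
    apply heinj
    refine dense v₀ (fun σ => e (χ σ)) (hlc.comp e) (fun w => ?_) σ
    rw [hθv₀, hχ']
  · -- at the other places of `S`
    apply heinj
    rw [he0]
    exact dense v (fun _ => 1) (IsLocallyConstant.const 1) (fun w => (hθS v hv hne _).symm) σ

/-- A finite sum of locally constant functions is locally constant. [folklore] -/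
private theorem isLocallyConstant_finset_sum {X ι A : Type*} [TopologicalSpace X] [AddCommMonoid A]
    (s : Finset ι) (f : ι → X → A) (h : ∀ i ∈ s, IsLocallyConstant (f i)) :
    IsLocallyConstant (fun x => ∑ i ∈ s, f i x) := by
  induction s using Finset.cons_induction with
  | empty =>
    simp only [Finset.sum_empty]
    exact IsLocallyConstant.const 0
  | cons a s ha ih =>
    simp only [Finset.sum_cons]
    exact (h a (Finset.mem_cons_self a s)).comp₂
      (ih fun i hi => h i (Finset.mem_cons_of_mem hi)) (· + ·)

end Galois

/-! ### §5. The discharge -/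

/-- **Clozel–Harris–Taylor 2008, Lemma 4.1.1 (Galois form, finite places) — discharge of the named
fact `ClozelHarrisTaylor2008.exists_character_restrict_eq`.**  The character is the sum over `v₀ ∈ S`
of the characters of `exists_character_restrict_eq_single` (prescribed at `v₀`, trivial at the other
places of `S`). [cite: ClozelHarrisTaylor2008, Lemma 4.1.1 (p. 116)]
[cite: CasselsFrohlichANT1967, Ch. VII §5.1–5.5, §6 (Tate)] -/
theorem exists_character_restrict_eq_holds : exists_character_restrict_eq := by
  intro F _ _ S χ hχ
  classical
  have hsingle : ∀ v₀ ∈ S, ∃ ψ : absoluteGaloisGroup F → AddCircle (1 : ℚ), IsLocallyConstant ψ ∧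
      (∀ σ τ, ψ (σ * τ) = ψ σ + ψ τ) ∧
      (∀ σ, ψ (absGaloisRestrict F (v₀.adicCompletion F) σ) = χ v₀ σ) ∧
      ∀ v ∈ S, v ≠ v₀ → ∀ σ, ψ (absGaloisRestrict F (v.adicCompletion F) σ) = 0 :=
    fun v₀ hv₀ => exists_character_restrict_eq_single S hv₀ (χ v₀) (hχ v₀ hv₀).1 (hχ v₀ hv₀).2
  choose! Ψ hΨlc hΨadd hΨself hΨother using hsingle
  refine ⟨fun σ => ∑ v ∈ S, Ψ v σ, isLocallyConstant_finset_sum S Ψ hΨlc, fun σ τ => ?_,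
    fun v hv σ => ?_⟩
  · change ∑ v ∈ S, Ψ v (σ * τ) = ∑ v ∈ S, Ψ v σ + ∑ v ∈ S, Ψ v τ
    rw [← Finset.sum_add_distrib]
    exact Finset.sum_congr rfl fun v hv => hΨadd v hv σ τ
  · change ∑ v' ∈ S, Ψ v' (absGaloisRestrict F (v.adicCompletion F) σ) = χ v σ
    rw [Finset.sum_eq_single_of_mem v hv fun v' hv' hne => hΨother v' hv' v hv hne.symm σ]
    exact hΨself v hv σ

/-! ### §6. The printed (idelic) form at finite places -/

section Idelic

variable {F : Type} [Field F] [NumberField F]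

/-- A finite product of elements of finite order (in a commutative group) has finite order.
[folklore] -/
private theorem isOfFinOrder_finset_prod {ι M : Type*} [CommMonoid M] (s : Finset ι) (f : ι → M)
    (h : ∀ i ∈ s, IsOfFinOrder (f i)) : IsOfFinOrder (∏ i ∈ s, f i) := by
  induction s using Finset.cons_induction with
  | empty => rw [Finset.prod_empty]; exact IsOfFinOrder.one
  | cons a s ha ih =>
    rw [Finset.prod_cons]
    exact (h a (Finset.mem_cons_self a s)).mul (ih fun i hi => h i (Finset.mem_cons_of_mem hi))

/-- **Clozel–Harris–Taylor 2008, Lemma 4.1.1 — the PRINTED (idelic) form, at finite places.**  «Suppose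
that `F` is a number field and that `S` is a finite set of places of `F`. Suppose also that
`χ_S : ∏_{v∈S} F_vˣ → ℚ̄ˣ` is a continuous character of finite order. Then there is a continuous
character `χ : Fˣ\𝔸_Fˣ → ℚ̄ˣ` such that `χ|_{∏_{v∈S} F_vˣ} = χ_S`.»  Here: for a finite set `S` of
FINITE places and, for `v ∈ S`, characters `χ_v : F_vˣ → ℂˣ` of finite order with open kernel
(= continuous characters of finite order into the discrete group `ℚ̄ˣ ⊂ ℂˣ`), there is a Hecke
character `θ` of `F` (a continuous character of `𝔸_Fˣ/Fˣ`) OF FINITE ORDER whose local component at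
every `v ∈ S` is `χ_v`.  Proof: write `χ_v = e ∘ χ'_v` with `χ'_v : F_vˣ → ℚ/ℤ` locally constant
additive (`e = exp(2πi·)` hits every element of finite order), take for each `v₀ ∈ S` the Hecke
character of §3 (component `χ_{v₀}` at `v₀`, trivial at the other places of `S` — the printed
construction with Chevalley's congruence subgroup and the extension from an open subgroup of finite
index), and multiply over `v₀ ∈ S`.  The real places of the printed statement (sign characters) are not
treated. [cite: ClozelHarrisTaylor2008, Lemma 4.1.1 (p. 116)] -/
theorem exists_heckeCharacter_isFiniteOrder_localComponent_eq (S : Finset (HeightOneSpectrum (𝓞 F)))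
    (χ : ∀ v : HeightOneSpectrum (𝓞 F), (v.adicCompletion F)ˣ →* ℂˣ)
    (hχ : ∀ v ∈ S, IsOpen ((χ v).ker : Set (v.adicCompletion F)ˣ) ∧ IsOfFinOrder (χ v)) :
    ∃ θ : HeckeCharacter F, θ.IsFiniteOrder ∧ ∀ v ∈ S, θ.localComponent v = χ v := by
  classical
  obtain ⟨e, he0, he, heinj, hesurj⟩ := exists_addCircle_character
  -- `e` as a homomorphism, for `e (n • q) = (e q) ^ n`
  let eA : AddCircle (1 : ℚ) →+ Additive ℂˣ :=
    { toFun := fun q => Additive.ofMul (e q)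
      map_zero' := by rw [he0]; rfl
      map_add' := fun x y => by rw [he]; rfl }
  have he_nsmul : ∀ (n : ℕ) (q : AddCircle (1 : ℚ)), e (n • q) = e q ^ n := fun n q => by
    have h := map_nsmul eA n q
    exact congrArg Additive.toMul h
  -- a section `κ` of `e` on the elements of finite order
  have hκ : ∀ z : ℂˣ, ∃ q : AddCircle (1 : ℚ), IsOfFinOrder z → e q = z := fun z => by
    by_cases hz : IsOfFinOrder z
    · obtain ⟨q, hq⟩ := hesurj z hz
      exact ⟨q, fun _ => hq⟩
    · exact ⟨0, fun h => absurd h hz⟩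
  choose κ hκ using hκ
  -- one Hecke character per place of `S`
  have hsingle : ∀ v₀ ∈ S, ∃ θ : HeckeCharacter F, θ.IsFiniteOrder ∧
      (∀ x, θ (localUnits v₀ x) = χ v₀ x) ∧ ∀ v ∈ S, v ≠ v₀ → ∀ x, θ (localUnits v x) = 1 := by
    intro v₀ hv₀
    obtain ⟨hopen, hfin⟩ := hχ v₀ hv₀
    -- `χ_{v₀} = e ∘ χ'` with `χ'` locally constant additive, killed by the order of `χ_{v₀}`
    have hfinx : ∀ x, IsOfFinOrder (χ v₀ x) := fun x => by
      obtain ⟨n, hn, hχn⟩ := hfin.exists_pow_eq_one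
      exact isOfFinOrder_iff_pow_eq_one.mpr ⟨n, hn, by rw [← MonoidHom.pow_apply, hχn, MonoidHom.one_apply]⟩
    set χ' : (v₀.adicCompletion F)ˣ → AddCircle (1 : ℚ) := fun x => κ (χ v₀ x) with hχ'def
    have hχ'e : ∀ x, e (χ' x) = χ v₀ x := fun x => hκ _ (hfinx x)
    have hlc' : IsLocallyConstant χ' :=
      (isLocallyConstant_of_isOpen_ker (χ v₀) hopen).comp κ
    have hadd' : ∀ x y, χ' (x * y) = χ' x + χ' y := fun x y =>
      heinj (by rw [he, hχ'e, hχ'e, hχ'e, map_mul])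
    obtain ⟨m, hm, hχm⟩ := hfin.exists_pow_eq_one
    have hχ'm : ∀ x, m • χ' x = 0 := fun x =>
      heinj (by rw [he_nsmul, hχ'e, he0, ← MonoidHom.pow_apply, hχm, MonoidHom.one_apply])
    obtain ⟨θ, hθfin, hθv₀, hθS⟩ :=
      exists_heckeCharacter_localComponent S hv₀ χ' hlc' hadd' hm hχ'm e he0 he
    exact ⟨θ, hθfin, fun x => by rw [hθv₀, hχ'e], hθS⟩
  choose! Θ hΘfin hΘself hΘother using hsingle
  refine ⟨∏ v ∈ S, Θ v, isOfFinOrder_finset_prod S Θ hΘfin, fun v hv => MonoidHom.ext fun x => ?_⟩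
  rw [HeckeCharacter.localComponent_apply, ← HeckeCharacter.evalIdele_apply (localUnits v x), map_prod,
    Finset.prod_eq_single_of_mem v hv fun w hw hne => ?_]
  · rw [HeckeCharacter.evalIdele_apply, hΘself v hv]
  · rw [HeckeCharacter.evalIdele_apply]
    exact hΘother w hw v hv hne.symm x

end Idelic

end ClozelHarrisTaylor2008

end Literature.NumberTheory.GaloisRepresentations

end
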